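import Mathlib
import HarnessLib
import Summits.AtomisticToContinuum.HydrodynamicLimit.Theses.RelayRaceLocality

/-!
# RelayRaceLocality · ConeLocalisation — the line `einstein-elevator` (definitions)

Support definitions for the crux item `stmt-AtomisticToContinuum-12504` (`ConeLocalisation`, route
RelayRaceLocality of `AtomisticToContinuum/HydrodynamicLimit`), written by its line lead a1
(prover-line-stmt-AtomisticToContinuum-12504-a1-0, 2026-08-17) for the line `einstein-elevator`
(crux-ideate round 2, ideator 5; merged with `free-fall-frame`, ideator 4), so that the registered stubs of
the line's skeleton (`Cruxes/ConeLocalisation/Lines/EinsteinElevatorSketch.lean`) are precise `Prop`s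
importable from `Theorems/`. `Prop`s only; nothing is asserted.

`ConeLocalisation` is LITERALLY `LightConeInLaw → NearConstantShortTimeHL → S` with `S = ShortTimeGuardedHL`
below (`coneLocalisation_iff_shortTimeGuardedHL`, `Iff.rfl`): the short-time guarded hydrodynamic limit,
guards on `[0, t]` = packing, `ρ ≤ M`, `θ ∈ [M⁻¹, M]`, `‖u‖ ≤ M`, all `∂, ∂², ∂³` of `(ρ, u, θ)` bounded by `M`,
and NO lower bound on `ρ`. Seven leads (0, c1–c5 and the disprover) showed that no line through the two
antecedents reaches `S` as typed (density-floor gap; the floored crux is the tree theorem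
`ConeLocalisation.coneLocalisationFloored_holds`, p137065). The line `einstein-elevator` replaces the floor
by a PROVABLE dynamic rigidity of the guard class and ONE foreign near-equilibrium input:

* `Elevator.GuardAt` — the level-`M` guard conjunction of `S` at `(s, x)`, verbatim;
* `Elevator.DynamicLogSlopeBound`, `Elevator.DynamicLogCurvatureBound` — the PDE a-priori bounds (orders 1
  and 2 of the ideator's `DynamicLogLipschitz`): guards alive on `[0, t] × 𝕋³` force
  `|∂ᵢ log ρ|, |∂ᵢ∂ⱼ log ρ| ≤ C Mᵃ / t` there (entropy transport + momentum budget along Lagrangian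
  trajectories: `‖u‖ ≤ M` resp. `‖∂u‖ ≤ M` at both ends of every path);
* `Elevator.NearAtmosphereOn`, `Elevator.DynamicNearAtmosphere` — relative `C⁰` nearness to an isothermal
  atmosphere on a ball, and its consequence for the guard class at the cone scale `ℓ₀ = t/(C Mᵃ)`
  (Taylor: steep ⇒ straight);
* `Elevator.GuardAtScale`, `Elevator.ElevatorOrbitHL` — the ONE FOREIGN STUB of the line (verbatim from the
  ideator's sketch): the near-equilibrium hydrodynamic limit around the elevator orbit
  {constants} ∪ {free-falling isothermal atmospheres}, hyperbolic-scaling covariant, for general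
  diameter/number families. It is NOT derivable from the route's antecedents and is of the calibre of
  the crux `NearConstantShortTimeHL` (stmt-12502); the line hands it back to the planner.

The composition `ElevatorOrbitHL → DynamicNearAtmosphere → S` (hence `→ ConeLocalisation`, the two
antecedents unused) is the line's transfer stub; `DynamicLogSlopeBound → DynamicLogCurvatureBound →
DynamicNearAtmosphere` its straightness stub.
-/

noncomputable section

namespace Summit.AtomisticToContinuum.HydrodynamicLimit.Theorems.ConeLocalisation

open scoped Topology
open Filter Set MeasureTheory
open Literature.MathematicalPhysics.KineticTheory Literature.Analysis.FluidPDE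
  Literature.Analysis.FunctionSpaces
open Summit.AtomisticToContinuum.HydrodynamicLimit.Theses.RelayRaceLocality

/-- **`S` — the short-time guarded hydrodynamic limit** (NO density floor): verbatim the consequent of
`RelayRaceLocality.ConeLocalisation` (= the antecedent of `RelayRaceLocality.RestartPrinciple`).
`∃ η₀ ∀ M ∃ τ₁ ∀ (a₀, θ₀, u₀) ∃ σ₀ ∀ σ < σ₀ ∀ classical solutions ∀ flows`, LLN at `0` ⇒ for `t < min T τ₁` with
packing `< η₀`, `ρ ≤ M`, `M⁻¹ ≤ θ ≤ M`, `‖u‖ ≤ M` and all derivatives of order `≤ 3` of `(ρ, u, θ)` bounded by `M`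
on `[0, t]`, LLN at `t`. [folklore] -/
@[conjecture] def ShortTimeGuardedHL : Prop :=
  ∃ η₀ : ℝ, 0 < η₀ ∧ ∀ M : ℝ, 0 < M → ∃ τ₁ : ℝ, 0 < τ₁ ∧ ∀ (a₀ θ₀ : T3 → ℝ) (u₀ : T3 → V3), Continuous a₀ → Continuous θ₀ → Continuous u₀ → (∀ x, 0 < a₀ x) → (∀ x, 0 < θ₀ x) → ∃ σ₀ : ℝ, 0 < σ₀ ∧ ∀ σ : ℝ, 0 < σ → σ < σ₀ → ∀ (T : ℝ) (ρ θ : ℝ → T3 → ℝ) (u : ℝ → T3 → V3), IsHardSphereEulerSolution σ T ρ u θ → ∀ Φ : (N : ℕ) → HardSphereFlow (Torus.geometry (Fin 3)) (hsDiameter σ N) (N + 1), TendstoHydroFieldsAt (fun N => localGibbsLaw σ a₀ u₀ θ₀ N (Φ N)) Φ ρ u θ 0 → ∀ t ∈ Set.Ico 0 (min T τ₁), (∀ s ∈ Set.Icc 0 t, ∀ x, ρ s x * σ ^ 3 < η₀ ∧ ρ s x ≤ M ∧ θ s x ≤ M ∧ M⁻¹ ≤ θ s x ∧ ‖u s x‖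 ≤ M ∧ ∀ i j k : Fin 3, |Torus.partialDeriv i (ρ s) x| ≤ M ∧ ‖Torus.partialDeriv i (u s) x‖ ≤ M ∧ |Torus.partialDeriv i (θ s) x| ≤ M ∧ |Torus.partialDeriv i (Torus.partialDeriv j (ρ s)) x| ≤ M ∧ ‖Torus.partialDeriv i (Torus.partialDeriv j (u s)) x‖ ≤ M ∧ |Torus.partialDeriv i (Torus.partialDeriv j (θ s)) x| ≤ M ∧ |Torus.partialDeriv i (Torus.partialDeriv j (Torus.partialDeriv k (ρ s))) x| ≤ M ∧ ‖Torus.partialDeriv i (Torus.partialDeriv j (Torus.partialDeriv k (u s))) x‖ ≤ M ∧ |Torus.partialDeriv i (Torus.partialDeriv j (Torus.partialDeriv k (θ s))) x| ≤ M) → TendstoHydroFieldsAt (fun N => localGibbsLaw σ a₀ u₀ θ₀ N (Φ N)) Φ ρ u θ t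

/-- The crux is literally `LightConeInLaw → NearConstantShortTimeHL → ShortTimeGuardedHL` (anchor stub of the
line `einstein-elevator`, registered on stmt-AtomisticToContinuum-12504). [folklore] -/
theorem stub_coneLocalisation_iff_shortTimeGuardedHL : ConeLocalisation ↔ (LightConeInLaw → NearConstantShortTimeHL → ShortTimeGuardedHL) := Iff.rfl

/-- The crux is literally `LightConeInLaw → NearConstantShortTimeHL → ShortTimeGuardedHL`. [folklore] -/
theorem coneLocalisation_iff_shortTimeGuardedHL :
    ConeLocalisation ↔ (LightConeInLaw → NearConstantShortTimeHL → ShortTimeGuardedHL) := Iff.rfl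

namespace Elevator

/-- The level-`M` guard conjunction of `S` (consequent of `ConeLocalisation`) at `(s, x)`, verbatim, with packing
threshold `η`. [folklore] -/
@[folklore] def GuardAt (η M σ : ℝ) (ρ θ : ℝ → T3 → ℝ) (u : ℝ → T3 → V3) (s : ℝ) (x : T3) : Prop :=
  ρ s x * σ ^ 3 < η ∧ ρ s x ≤ M ∧ θ s x ≤ M ∧ M⁻¹ ≤ θ s x ∧ ‖u s x‖ ≤ M ∧ ∀ i j k : Fin 3,
    |Torus.partialDeriv i (ρ s) x| ≤ M ∧ ‖Torus.partialDeriv i (u s) x‖ ≤ M ∧ |Torus.partialDeriv i (θ s) x| ≤ M ∧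
    |Torus.partialDeriv i (Torus.partialDeriv j (ρ s)) x| ≤ M ∧ ‖Torus.partialDeriv i (Torus.partialDeriv j (u s)) x‖ ≤ M ∧
    |Torus.partialDeriv i (Torus.partialDeriv j (θ s)) x| ≤ M ∧
    |Torus.partialDeriv i (Torus.partialDeriv j (Torus.partialDeriv k (ρ s))) x| ≤ M ∧
    ‖Torus.partialDeriv i (Torus.partialDeriv j (Torus.partialDeriv k (u s))) x‖ ≤ M ∧
    |Torus.partialDeriv i (Torus.partialDeriv j (Torus.partialDeriv k (θ s))) x| ≤ M

/-- **Dynamic log-slope bound (order 1 of the dynamic log-Lipschitz rigidity of the guard class).** There are a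
packing band `η₁`, a constant `C` and an exponent `a` such that for every level `M ≥ 1`, every reduced diameter
`σ ∈ (0, 1]`, every classical hs-Euler solution and every `0 < t < T` with `t · C Mᵃ ≤ 1`: if the level-`M` guards
of `S` hold on `[0, t] × 𝕋³`, then `|∂ᵢ log ρ| ≤ C Mᵃ / t` on `[0, t] × 𝕋³`. (Proof route: along a Lagrangian
trajectory `D_t uⱼ = -Gⱼ`, `G = ∇p/ρ = θκ ∇log ρ + Z ∇θ`, and `|D_t G| ≤ A(M) |G| + B(M)` from the mass and
temperature equations; `‖u‖ ≤ M` at both ends of the path gives `|∫ G| ≤ 2M`, whence `|G| ≤ C M/t`; no density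
floor enters.) [folklore] -/
@[conjecture] def DynamicLogSlopeBound : Prop :=
  ∃ η₁ : ℝ, 0 < η₁ ∧ ∃ C : ℝ, 0 < C ∧ ∃ a : ℕ, ∀ M : ℝ, 1 ≤ M →
    ∀ (σ T : ℝ) (ρ θ : ℝ → T3 → ℝ) (u : ℝ → T3 → V3), 0 < σ → σ ≤ 1 → IsHardSphereEulerSolution σ T ρ u θ →
    ∀ t : ℝ, 0 < t → t < T → t * (C * M ^ a) ≤ 1 →
    (∀ s ∈ Set.Icc 0 t, ∀ x, GuardAt η₁ M σ ρ θ u s x) →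
    ∀ s ∈ Set.Icc 0 t, ∀ x, ∀ i : Fin 3,
      |Torus.partialDeriv i (fun y => Real.log (ρ s y)) x| ≤ C * M ^ a / t

/-- **Dynamic log-curvature bound (order 2 of the dynamic log-Lipschitz rigidity of the guard class).** Same
hypotheses as `DynamicLogSlopeBound` (with its own constants); conclusion `|∂ᵢ∂ⱼ log ρ| ≤ C Mᵃ / t` on
`[0, t] × 𝕋³`. (Proof route: the same both-ends argument one derivative up, `D_t ∂ᵢuⱼ = -∂ᵢGⱼ - (∂u ∂u)ᵢⱼ` with
`‖∂u‖ ≤ M` at both ends, fed by the order-1 bound.) [folklore] -/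
@[conjecture] def DynamicLogCurvatureBound : Prop :=
  ∃ η₁ : ℝ, 0 < η₁ ∧ ∃ C : ℝ, 0 < C ∧ ∃ a : ℕ, ∀ M : ℝ, 1 ≤ M →
    ∀ (σ T : ℝ) (ρ θ : ℝ → T3 → ℝ) (u : ℝ → T3 → V3), 0 < σ → σ ≤ 1 → IsHardSphereEulerSolution σ T ρ u θ →
    ∀ t : ℝ, 0 < t → t < T → t * (C * M ^ a) ≤ 1 →
    (∀ s ∈ Set.Icc 0 t, ∀ x, GuardAt η₁ M σ ρ θ u s x) →
    ∀ s ∈ Set.Icc 0 t, ∀ x, ∀ i j : Fin 3,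
      |Torus.partialDeriv i (Torus.partialDeriv j (fun y => Real.log (ρ s y))) x| ≤ C * M ^ a / t

/-- Relative `C⁰` nearness, on the ball of radius `R` about `x₀`, of the datum `(ρ, u, θ)` to the ISOTHERMAL
ATMOSPHERE fitted at `x₀` with log-density slope `g`: `|log ρ(x) − log ρ(x₀) − ⟪g, x − x₀⟫| ≤ δ`,
`‖u(x) − u(x₀)‖ ≤ δ`, `|θ(x)/θ(x₀) − 1| ≤ δ` (minimal-image chart `Torus.reprSym`, valid for `R < 1/2`).
[folklore] -/
@[folklore] def NearAtmosphereOn (ρ θ : T3 → ℝ) (u : T3 → V3) (x₀ : T3) (g : V3) (R δ : ℝ) : Prop :=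
  ∀ x, Torus.euclidDist x x₀ < R →
    |Real.log (ρ x) - Real.log (ρ x₀) - inner ℝ g (Torus.reprSym (x - x₀))| ≤ δ ∧
    ‖u x - u x₀‖ ≤ δ ∧ |θ x / θ x₀ - 1| ≤ δ

/-- **Dynamic near-atmosphere property of the guard class at the cone scale** ("steep ⇒ straight"). There are
`η₁, C, a` such that for every level `M ≥ 1`, every number of scale heights `K ≥ 1` and every tolerance `δ > 0`
there is a horizon `τ > 0` with: for `σ ∈ (0, 1]`, every classical hs-Euler solution and every `0 < t < T`,
`t ≤ τ`, if the level-`M` guards of `S` hold on `[0, t] × 𝕋³` then, with `ℓ₀ := t / (C Mᵃ)`, the time-`0` datum is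
around EVERY point `x₀` `δ`-near, on the ball of radius `K ℓ₀`, to an isothermal atmosphere of slope `g` with
`‖g‖ ℓ₀ ≤ 1` (namely `g = ∇ log ρ(0, x₀)`; second-order Taylor with `DynamicLogSlopeBound`,
`DynamicLogCurvatureBound` and the guards `‖∂u‖, |∂θ| ≤ M`, `θ ≥ M⁻¹`). This is exactly the hypothesis of
`ElevatorOrbitHL` at scale `ℓ₀`. [folklore] -/
@[conjecture] def DynamicNearAtmosphere : Prop :=
  ∃ η₁ : ℝ, 0 < η₁ ∧ ∃ C : ℝ, 0 < C ∧ ∃ a : ℕ, ∀ M : ℝ, 1 ≤ M → ∀ K : ℝ, 1 ≤ K → ∀ δ : ℝ, 0 < δ →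
    ∃ τ : ℝ, 0 < τ ∧
    ∀ (σ T : ℝ) (ρ θ : ℝ → T3 → ℝ) (u : ℝ → T3 → V3), 0 < σ → σ ≤ 1 → IsHardSphereEulerSolution σ T ρ u θ →
    ∀ t : ℝ, 0 < t → t < T → t ≤ τ →
    (∀ s ∈ Set.Icc 0 t, ∀ x, GuardAt η₁ M σ ρ θ u s x) →
    ∀ x₀ : T3, ∃ g : V3, ‖g‖ * (t / (C * M ^ a)) ≤ 1 ∧
      NearAtmosphereOn (ρ 0) (θ 0) (u 0) x₀ g (K * (t / (C * M ^ a))) δ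

/-- Scale-covariant guards at scale `ℓ` (the image of `GuardAt` under the hyperbolic zoom `x ↦ x/ℓ`, `t ↦ t/ℓ`, which
leaves `ρ, u, θ` invariant and multiplies `k`-th derivatives by `ℓᵏ`): sizes at level `M`, `k`-th derivatives
bounded by `M/ℓᵏ`. For `ℓ = 1` it is `GuardAt`; for `ℓ ≤ 1` it is WEAKER than `GuardAt`. [folklore] -/
@[folklore] def GuardAtScale (η M ℓ σ : ℝ) (ρ θ : ℝ → T3 → ℝ) (u : ℝ → T3 → V3) (s : ℝ) (x : T3) : Prop :=
  ρ s x * σ ^ 3 < η ∧ ρ s x ≤ M ∧ θ s x ≤ M ∧ M⁻¹ ≤ θ s x ∧ ‖u s x‖ ≤ M ∧ ∀ i j k : Fin 3,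
    |Torus.partialDeriv i (ρ s) x| ≤ M / ℓ ∧ ‖Torus.partialDeriv i (u s) x‖ ≤ M / ℓ ∧ |Torus.partialDeriv i (θ s) x| ≤ M / ℓ ∧
    |Torus.partialDeriv i (Torus.partialDeriv j (ρ s)) x| ≤ M / ℓ ^ 2 ∧
    ‖Torus.partialDeriv i (Torus.partialDeriv j (u s)) x‖ ≤ M / ℓ ^ 2 ∧
    |Torus.partialDeriv i (Torus.partialDeriv j (θ s)) x| ≤ M / ℓ ^ 2 ∧
    |Torus.partialDeriv i (Torus.partialDeriv j (Torus.partialDeriv k (ρ s))) x| ≤ M / ℓ ^ 3 ∧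
    ‖Torus.partialDeriv i (Torus.partialDeriv j (Torus.partialDeriv k (u s))) x‖ ≤ M / ℓ ^ 3 ∧
    |Torus.partialDeriv i (Torus.partialDeriv j (Torus.partialDeriv k (θ s))) x| ≤ M / ℓ ^ 3

/-- **The foreign stub of the line — `ElevatorOrbitHL`** (verbatim from the ideator's sketch
`Cruxes/ConeLocalisation/EinsteinElevatorSketch.lean`): near-equilibrium hydrodynamic limit around the ELEVATOR
ORBIT {constants} ∪ {free-falling isothermal atmospheres}, hyperbolic-scaling covariant. For every level `M` and
natural horizon `Θ` there are `K ≥ 1` and `δ > 0` such that for general diameter/number families (as in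
`NearConstantShortTimeHL`): if at ONE admissible scale `ℓ₀` the time-`0` datum is, around EVERY point, `δ`-near
some atmosphere of slope `‖g‖ ≤ 1/ℓ₀` on the ball of radius `K ℓ₀`, then the LLN at `0` propagates to every
`t < Θ ℓ₀` at which the level-`M` guards AT SCALE `ℓ₀` hold on `[0, t]`. Face `g = 0`: the scale-covariant
`NearConstantShortTimeHL`; face `g ≠ 0`: its fielded twin through the Galilean elevator
`(x, v) ↦ (x + ½ a t², v + a t)` (at `δ = 0` the barometric Gibbs state, invariant under the uniformly forced
hard-sphere flow). UNPROVED; of the calibre of stmt-AtomisticToContinuum-12502; not derivable from the route's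
antecedents. -/
@[conjecture] def ElevatorOrbitHL : Prop :=
  ∃ η₀ : ℝ, 0 < η₀ ∧ ∀ M : ℝ, 0 < M → ∀ Θ : ℝ, 0 < Θ → ∃ K : ℝ, 1 ≤ K ∧ ∃ δ : ℝ, 0 < δ ∧
    ∀ (a₀ θ₀ : T3 → ℝ) (u₀ : T3 → V3), Continuous a₀ → Continuous θ₀ → Continuous u₀ → (∀ x, 0 < a₀ x) → (∀ x, 0 < θ₀ x) →
    ∃ σ₀ : ℝ, 0 < σ₀ ∧ ∀ σ : ℝ, 0 < σ → σ < σ₀ →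
    ∀ (ε : ℕ → ℝ) (n : ℕ → ℕ), (∀ N, 0 < ε N) → Tendsto ε atTop (nhds 0) → Tendsto (fun N => (n N : ℝ) * ε N ^ 3) atTop (nhds (σ ^ 3)) →
    ∀ (T : ℝ) (ρ θ : ℝ → T3 → ℝ) (u : ℝ → T3 → V3), IsHardSphereEulerSolution σ T ρ u θ →
    ∀ ℓ₀ : ℝ, 0 < ℓ₀ → K * ℓ₀ ≤ 1 / 4 →
    (∀ x₀ : T3, ∃ g : V3, ‖g‖ * ℓ₀ ≤ 1 ∧ NearAtmosphereOn (ρ 0) (θ 0) (u 0) x₀ g (K * ℓ₀) δ) →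
    ∀ Φ : (N : ℕ) → HardSphereFlow (Torus.geometry (Fin 3)) (ε N) (n N),
    let P : (N : ℕ) → Measure (Config (n N) (Fin 3) T3) := fun N =>
      particleLaw (Φ N) (canonicalDensity (Torus.geometry (Fin 3)) (ε N) (n N) (localGibbsProfile a₀ u₀ θ₀))
    (∀ N, IsProbabilityMeasure (P N)) →
    (∀ χ : T3 → ℝ, Continuous χ → ∀ δ' : ℝ, 0 < δ' →
      Tendsto (fun N => P N {z | δ' < |empiricalDensityField ((Φ N).flow 0 z) χ - ∫ x, χ x * ρ 0 x|}) atTop (nhds 0) ∧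
      Tendsto (fun N => P N {z | δ' < ‖empiricalMomentumField ((Φ N).flow 0 z) χ - ∫ x, (χ x * ρ 0 x) • u 0 x‖}) atTop (nhds 0) ∧
      Tendsto (fun N => P N {z | δ' < |empiricalEnergyField ((Φ N).flow 0 z) χ - ∫ x, χ x * totalEnergyDensity (ρ 0 x) (u 0 x) (θ 0 x)|}) atTop (nhds 0)) →
    ∀ t ∈ Set.Ico 0 (min T (Θ * ℓ₀)), (∀ s ∈ Set.Icc 0 t, ∀ x, GuardAtScale η₀ M ℓ₀ σ ρ θ u s x) →
    ∀ χ : T3 → ℝ, Continuous χ → ∀ δ' : ℝ, 0 < δ' →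
      Tendsto (fun N => P N {z | δ' < |empiricalDensityField ((Φ N).flow t z) χ - ∫ x, χ x * ρ t x|}) atTop (nhds 0) ∧
      Tendsto (fun N => P N {z | δ' < ‖empiricalMomentumField ((Φ N).flow t z) χ - ∫ x, (χ x * ρ t x) • u t x‖}) atTop (nhds 0) ∧
      Tendsto (fun N => P N {z | δ' < |empiricalEnergyField ((Φ N).flow t z) χ - ∫ x, χ x * totalEnergyDensity (ρ t x) (u t x) (θ t x)|}) atTop (nhds 0)

/-- `GuardAt` at level `M` implies `GuardAtScale` at every scale `ℓ ∈ (0, 1]` (derivative bounds `M ≤ M / ℓᵏ`).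
[folklore] -/
theorem guardAtScale_of_guardAt {η M ℓ σ : ℝ} {ρ θ : ℝ → T3 → ℝ} {u : ℝ → T3 → V3} {s : ℝ} {x : T3}
    (hM : 0 ≤ M) (hℓ : 0 < ℓ) (hℓ1 : ℓ ≤ 1) (h : GuardAt η M σ ρ θ u s x) :
    GuardAtScale η M ℓ σ ρ θ u s x := by
  obtain ⟨h1, h2, h3, h4, h5, h6⟩ := h
  have hk : ∀ k : ℕ, M ≤ M / ℓ ^ k := fun k => by
    rw [le_div_iff₀ (pow_pos hℓ k)]
    exact mul_le_of_le_one_right hM (pow_le_one₀ hℓ.le hℓ1)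
  have hk1 : M ≤ M / ℓ := by simpa using hk 1
  refine ⟨h1, h2, h3, h4, h5, fun i j k => ?_⟩
  obtain ⟨d1, d2, d3, d4, d5, d6, d7, d8, d9⟩ := h6 i j k
  exact ⟨d1.trans hk1, d2.trans hk1, d3.trans hk1, d4.trans (hk 2), d5.trans (hk 2), d6.trans (hk 2),
    d7.trans (hk 3), d8.trans (hk 3), d9.trans (hk 3)⟩

end Elevator

end Summit.AtomisticToContinuum.HydrodynamicLimit.Theorems.ConeLocalisation

end
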